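import Summits.QuantumFields.YangMills.Theorems.BalabanUVNodesN06DgLegAtPinsPhysPU

/-!
# BalabanUVNodes ∕ N06 ([B9], `Dag.B9_main`) — ROWS 20–21's PROBE LEGS `hXd` (Φ^X_β∘∇_{U,ν}∘G₀∘D_U : `bH13 x U → 𝔠_{P_X}^{(β−1)}`) AND `pYDH` (Φ^Y_β∘∇_U∘G₀∘D_U :
# `bH13 x U → 𝔠_{P_Y}^{(β−1)}`) DERIVED ABOVE CLOSED THRESHOLDS AT THE PRINT-WEIGHTED PIN (P2′) `bH13 x U := bHZPG (taxiS U) w13` (repair (A′) of LOCATED-U6) from the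
# PRINT-LITERAL (3.45) members `h45X′ ∕ h45Y′ : bHZKP (taxiB U) (sch β) → 𝔠_P^{(β−1)}`, the plaquette binder `hF` and the member facts — dag-n06-l's generic
# `pYDH_of_h45Y_one` (p682679; for the X-probe read at `D ↦ ∇_{U,ν}`, `Φ^Y ↦ Φ^X_β`, `blkPY ↦ blkPX`) with their length-free J-letter `hJ_print` (p683285)

Track A of `YM-PLAN.md` (cell `pub-ymgap`, HUMAN RULING D-0062), node **N06** = [Balaban1985BackgroundPropagators] Thms 3.1–3.15; seat `pub-ymgap-dag-n06-d`
(gen 16).  WHY (LOCATED-U6, dag-n06-l g24 `BH13-UNITS-MEMO.md` v3 + kernel form p683935; WORD (A′) by this seat, cell INBOX 2026-08-29 ≈01:3xZ): at the option-(2) pin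
(P2) the `(Lʲη)⁻¹`-weighted graded class over-pays one length in the sup channel; at the PRINT-WEIGHTED pin (P2′) (`B9SmoothHolderClassP.bHZPG`, unit member ⇔
`‖F‖^{ξ′}_s + |F| ≤ 2Lʲ′η`) the displayed (3.45) members are VERBATIM instances: `h45Y′ β μ : HasMaj (bHZKP (taxiB U) (sch β)) (cNormR … blkPY (β−1)) (Φ^Y_β∘∇_U∘G₀∘D*_{U,μ})
(BiY β·e^{−δ45 d})` and `h45X′ ν μ β : HasMaj (bHZKP (taxiB U) (sch β)) (cNormR … blkPX (β−1)) (Φ^X_β∘∇_{U,ν}∘G₀∘D*_{U,μ}) (BZ β·e^{−δ45 d})` — print's (3.45) with input exponent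
`β + ε = sch β ∈ (β,1)`, NO `(Lʲη)^{−β}` factor in the kernel (the target class `𝔠_P^{(β−1)}` carries the dimension).  THIS FILE is the (P2′) twin of `N06XdLegAtPinsPhysRU` (p675038)
and `N06YdLegAtPinsPhysRU` (p678214): same ∃-packaging, same rate choices (`α := 1∕2`, `δF := δ45 − δ₃`, `σ := 1`, `δJ := δ₃ + 1 + δF∕2`), the J-letter now dag-n06-l's
length-free `hJ_print` (constant `CJG d ℓ b (sch β) θ_L (w13 (sch β)) δJ·L`), CLOSED constant functions
`β ↦ (d+1)·((1+C_Lip)·B(β)·(CJG d ℓ (trBasis N) (sch β) (thetaL d ℓ ϑF) (w13 (sch β)) δJ·L)·max c₁ 0)`: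
* ★★ `hXd_of_pinsP_geo9Y : ∃ MX BdX, (∀ β ∈ [0,1), 0 ≤ BdX β) ∧ ∀ x, MX ≤ M → … → ∀ ν β, HasMaj (bH13 x U) (cNormR … blkPX (β−1)) ((Φ^X_β∘∇_{U,ν}∘G₀)∘D_U) (BdX β·e^{−δ₃d})`;
* ★★ `pYDH_of_pinsP_geo9Y : ∃ MY BhD, (∀ β ∈ [0,1), 0 ≤ BhD β) ∧ ∀ x, MY ≤ M → … → ∀ β, HasMaj (bH13 x U) (cNormR … blkPY (β−1)) ((Φ^Y_β∘∇_U∘G₀)∘D_U) (BhD β·e^{−δ₃d})`.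
HONEST FRAMING.  Kernel bookkeeping (∃-packaging of landed Literature theorems with landed member-fact theorems and explicit rate choices); the (3.45) members and the
plaquette binder `hF` are HYPOTHESES of printed species; nothing of [B9] asserted; COUNT-NEUTRAL; N06 NOT discharged; K1⁹ NOT closed; one finite 𝕋⁴ programme at fixed `ε` —
NOT continuum ∕ OS ∕ mass gap ∕ Clay.  0 `def`, 0 `sorry`.
-/

noncomputable section

namespace Summit.QuantumFields.YangMills.BalabanUVNodes.N06XdYdLegAtPinsPhysPU

open Literature.MathematicalPhysics.QuantumFieldTheory.Balaban1983to89
open Literature.MathematicalPhysics.QuantumFieldTheory.Balaban1983to89.Node00 (FBondY IBondY SiteY levY toKT CfgY)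
open Literature.MathematicalPhysics.QuantumFieldTheory.Balaban1983to89.B9Thm34Ext (toB6)
open Literature.MathematicalPhysics.QuantumFieldTheory.Balaban1983to89.B11SectG (HasMaj BlockNorm RowSum)
open Literature.MathematicalPhysics.QuantumFieldTheory.Balaban1983to89.B9Thm312Whole (cNorm GeoOK)
open Literature.MathematicalPhysics.QuantumFieldTheory.Balaban1983to89.B9Thm312WholeClasses (cNormR)
open Literature.MathematicalPhysics.QuantumFieldTheory.Balaban1983to89.B9RWSums343Holder (HolderProbes)
open Literature.MathematicalPhysics.QuantumFieldTheory.Balaban1983to89.B9RWSums343to347Whole (Facts347)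
open Literature.MathematicalPhysics.QuantumFieldTheory.Balaban1983to89.B9RWSums346SecondDiff (DirOps310)
open Literature.MathematicalPhysics.QuantumFieldTheory.Balaban1983to89.B9Thm310Whole (Ops310)
open Literature.MathematicalPhysics.QuantumFieldTheory.Balaban1983to89.B9CoReadingCoords (coordOpK XBK blkBK cdBₗ cdsBₗ DcoK)
open Literature.MathematicalPhysics.QuantumFieldTheory.Balaban1983to89.B9CoReadingCoordsS (XSK sIK)
open Literature.MathematicalPhysics.QuantumFieldTheory.Balaban1983to89.B9CoReadingCoordsH (XHK)
open Literature.MathematicalPhysics.QuantumFieldTheory.Balaban1983to89.B9CoReadingCoordsHolder (PK)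
open Literature.MathematicalPhysics.QuantumFieldTheory.Balaban1983to89.B9CoReadingCoordsTranspose (TrIdx trBasis)
open Literature.MathematicalPhysics.QuantumFieldTheory.Balaban1983to89.B9PinMembersKLevelV1 (MemberY geo9Y bg9Y)
open Literature.MathematicalPhysics.QuantumFieldTheory.Balaban1983to89.B9BackgroundsKLevelV1R (RegFamY bg9YR MemOfFam mem_of_reg335R)
open Literature.MathematicalPhysics.QuantumFieldTheory.Balaban1983to89.B9GeoLemma21KLevelV1 (geo9Y_len_pos geo9Y_dist_triangle geo9Y_dist_comm rowSum261_geo9Y)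
open Literature.MathematicalPhysics.QuantumFieldTheory.Balaban1983to89.B9GeoNormsKLevelV1 (geo9K geo9K_dist_nonneg)
open Literature.MathematicalPhysics.QuantumFieldTheory.Balaban1983to89.B7Prop2SpecialUnitary (specialUnitaryUnits)
open Literature.MathematicalPhysics.QuantumFieldTheory.Balaban1983to89.B9RWSums347DefiniteFaces (exp261 facts347_exp261_geo9Y)
open B6GlobalChartV1 (PV blkV1) open B6Ineq2142KLevelV1 (β lvl) open B6Geom246MultiLevelTorus (geomT)
open Node00.OpsYSectDCoords (DvcoKH) open Node00.OpsYNablaBridge (chartY)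
open B9MultiscaleSmoothPartitionYLip (CLip) open B9GradViaDivLettersTransported (taxiS taxiB)
open Literature.MathematicalPhysics.QuantumFieldTheory.Balaban1983to89.B9Thm313WholeDvHolderAtPinsGraded (thetaL CJG thetaL_nonneg CJG_nonneg)
open Literature.MathematicalPhysics.QuantumFieldTheory.Balaban1983to89.B9TaxiTransportLadder (plaqV)
open Summit.QuantumFields.YangMills.BalabanUVNodes.N06HolderPinsGradedAtRecord (links_le_one)
open Literature.MathematicalPhysics.QuantumFieldTheory.Balaban1983to89.B9Thm313WholeDvHolderAtPinsPrint (hJ_print)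
open Literature.MathematicalPhysics.QuantumFieldTheory.Balaban1983to89.B9Thm313WholeDvHolderFromDdsFree (pYDH_of_h45Y_one)
open B9SmoothHolderClassP (bHZKP bHZPG bHZKP_κ) open B9SmoothHolderClassTClosure (abs_cf_eq_nKT) open B9GradViaDivLettersAtPins (JcoKH DvcoKH_eq_sum) open B6Prop22KLevelTorusCensusEta (nKT)
open Summit.QuantumFields.YangMills.BalabanUVNodes.N06XdLegAtPinsPhysRU (one_le_CLip)
open Literature.MathematicalPhysics.QuantumFieldTheory.Balaban1983to89.B9RWSums347DefiniteFaces (geo9Y_scalars)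
open scoped Matrix.Norms.L2Operator

variable {N : ℕ} {d ℓ : ℕ} {hd : 1 ≤ d + 1} {hL : Odd (ℓ + 1) ∧ 1 < ℓ + 1} {b₀ b₁ : ℝ} {Mstar : ℕ}

/-- ★★ **`hXd` DERIVED ABOVE A CLOSED THRESHOLD AT THE PRINT-WEIGHTED PIN (P2′)** (module docstring): for any target rate `0 ≤ δ₃ < δ45`, from the PRINT-LITERAL
Φ^X-(3.45) members `h45X′` (source `bHZKP (taxiB U) (sch β)`, target `𝔠_{P_X}^{(β−1)}`, rate `δ45`, constants `BZ β`), the plaquette binder `hF` (budget `ϑF ≥ 0`) and the pin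
(P2′), there are a threshold `MX` and a non-negative constant function `BdX` with the certificate's `hXd` at rate `δ₃` for every member above `MX` — dag-n06-l's generic
`pYDH_of_h45Y_one` at `D ↦ ∇_{U,ν}`, `Φ^Y ↦ Φ^X_β` with the length-free J-letter `hJ_print`, `Facts347` (`α := 1∕2`, `δF := δ45 − δ₃`) and `RowSum` (`σ := 1`) discharged
at the geometry of record. [cite: Balaban1985BackgroundPropagators, Thm 3.3 p.399 + (3.45) p.398 + (3.3) p.390 + (3.40) p.397 + (3.35) p.396; Balaban1984PropagatorsII, (2.52)–(2.56) pp.232–233 + Lemma 2.1 (2.60)–(2.61) p.234] -/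
theorem hXd_of_pinsP_geo9Y [NeZero N] [∀ x : MemberY d ℓ hd hL b₀ b₁ Mstar, Fintype (geo9Y x).Site]
    {R₁ R₂ : RegFamY d ℓ hd hL b₀ b₁ Mstar (Matrix (Fin N) (Fin N) ℂ)} (H : MemberY d ℓ hd hL b₀ b₁ Mstar → Prop)
    (bI : ∀ x : MemberY d ℓ hd hL b₀ b₁ Mstar, FBondY x.toKIdx → IBondY x.toKIdx)
    (hβ1 : ∀ (x : MemberY d ℓ hd hL b₀ b₁ Mstar) (f : FBondY x.toKIdx), (geomT x.D).dist (β x.hN x.D x.hk (bI x f)) (blkV1 x.hN x.D f) ≤ 1)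
    (hbI0 : ∀ (x : MemberY d ℓ hd hL b₀ b₁ Mstar) (f : FBondY x.toKIdx), bI x f = bI x ⟨f.src, 0⟩)
    (hGR : MemOfFam (specialUnitaryUnits (Fin N)) R₁) (c : ℝ) {M₀ a₀ : ℝ} {ϑF : ℝ} (hϑF : 0 ≤ ϑF)
    (hF : ∀ x : MemberY d ℓ hd hL b₀ b₁ Mstar, letI : Fintype (geo9K x.toKIdx).Site := (inferInstance : Fintype (geo9Y x).Site); M₀ ≤ (geo9Y x).M → ∀ α₀ : ℝ, 0 < α₀ → (geo9Y x).M * α₀ ≤ a₀ → ∀ U : (bg9YR (Matrix (Fin N) (Fin N) ℂ) (specialUnitaryUnits (Fin N)) R₁ R₂ x).Cfg, (bg9YR (Matrix (Fin N) (Fin N) ℂ) (specialUnitaryUnits (Fin N)) R₁ R₂ x).Reg335 c α₀ U →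
      (bg9YR (Matrix (Fin N) (Fin N) ℂ) (specialUnitaryUnits (Fin N)) R₁ R₂ x).Reg336 c α₀ U → ∀ (y : Site (PV d ℓ x.m x.K hd hL) 0) (μ' ν' : Fin (d + 1)),
        ‖(plaqV U y μ' ν' : Matrix (Fin N) (Fin N) ℂ) - 1‖ ≤ ϑF * (((((ℓ + 1 : ℕ) : ℝ)) ^ levY x.toKIdx (chartY x.toKIdx y))⁻¹))
    (w13 : ℝ → ℝ) (hw13₀ : ∀ s, 0 ≤ w13 s) (hw13₁ : ∀ s, w13 s ≤ 1) (sch : ℝ → ℝ) (hsch0 : ∀ β', 0 ≤ β' → β' < 1 → 0 < sch β') (hsch1 : ∀ β', 0 ≤ β' → β' < 1 → sch β' < 1)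
    (hwsch : ∀ β', 0 ≤ β' → β' < 1 → 0 < w13 (sch β'))
    (bH13 : ∀ x : MemberY d ℓ hd hL b₀ b₁ Mstar, (bg9YR (Matrix (Fin N) (Fin N) ℂ) (specialUnitaryUnits (Fin N)) R₁ R₂ x).Cfg → BlockNorm (toB6 (geo9Y x) 1 (H x)) (XSK (TrIdx N) x.toKIdx → ℝ))
    (hbH13 : ∀ (x : MemberY d ℓ hd hL b₀ b₁ Mstar) (U : (bg9YR (Matrix (Fin N) (Fin N) ℂ) (specialUnitaryUnits (Fin N)) R₁ R₂ x).Cfg), bH13 x U =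
      letI : Fintype (geo9K x.toKIdx).Site := (inferInstance : Fintype (geo9Y x).Site);
      bHZPG (κ := TrIdx N) x.toKIdx (trBasis N) (taxiS x.toKIdx (bg9YR (Matrix (Fin N) (Fin N) ℂ) (specialUnitaryUnits (Fin N)) R₁ R₂ x) (fun U => U) U) (R := (1 : ℝ)) (H := H x) w13 hw13₀ hw13₁)
    {ιA AA : MemberY d ℓ hd hL b₀ b₁ Mstar → Type}
    (𝔬A : ∀ x : MemberY d ℓ hd hL b₀ b₁ Mstar, Ops310 (geo9Y x) (bg9YR (Matrix (Fin N) (Fin N) ℂ) (specialUnitaryUnits (Fin N)) R₁ R₂ x) (XBK (TrIdx N) x.toKIdx) (XBK (TrIdx N) x.toKIdx) (ιA x) (AA x))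
    (𝔬12 : ∀ x : MemberY d ℓ hd hL b₀ b₁ Mstar, B9Thm312Whole.Ops (geo9Y x) (bg9YR (Matrix (Fin N) (Fin N) ℂ) (specialUnitaryUnits (Fin N)) R₁ R₂ x) (XBK (TrIdx N) x.toKIdx) (XBK (TrIdx N) x.toKIdx) (XHK (TrIdx N) x.toKIdx) (XSK (TrIdx N) x.toKIdx))
    (hDvco12 : ∀ (x : MemberY d ℓ hd hL b₀ b₁ Mstar) (U : (bg9YR (Matrix (Fin N) (Fin N) ℂ) (specialUnitaryUnits (Fin N)) R₁ R₂ x).Cfg), (𝔬12 x).Dv U = DvcoKH x.toKIdx (trBasis N) (bg9YR (Matrix (Fin N) (Fin N) ℂ) (specialUnitaryUnits (Fin N)) R₁ R₂ x) (fun U => U) U)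
    (𝔡A : ∀ x : MemberY d ℓ hd hL b₀ b₁ Mstar, DirOps310 (𝔬A x) (Fin (d + 1)))
    (h𝔡As : ∀ (x : MemberY d ℓ hd hL b₀ b₁ Mstar) (U : (bg9YR (Matrix (Fin N) (Fin N) ℂ) (specialUnitaryUnits (Fin N)) R₁ R₂ x).Cfg), (𝔡A x).Dsd U = fun μ => coordOpK (trBasis N) (fun _ : Fin (d + 1) => cdsBₗ x.toKIdx U μ))
    (𝔭A : ∀ x : MemberY d ℓ hd hL b₀ b₁ Mstar, HolderProbes (geo9Y x) (bg9YR (Matrix (Fin N) (Fin N) ℂ) (specialUnitaryUnits (Fin N)) R₁ R₂ x) (XBK (TrIdx N) x.toKIdx) (XBK (TrIdx N) x.toKIdx) (PK (FBondY x.toKIdx) (Fin (d + 1)) (TrIdx N)) (PK (FBondY x.toKIdx) (Fin (d + 1)) (TrIdx N)))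
    {δ45 δ₃ : ℝ} (hδ₃ : 0 ≤ δ₃) (hδ : δ₃ < δ45) {BZ : ℝ → ℝ} (hBZ : ∀ β', 0 ≤ β' → β' < 1 → 0 ≤ BZ β')
    (h45X : ∀ x : MemberY d ℓ hd hL b₀ b₁ Mstar, letI : Fintype (geo9K x.toKIdx).Site := (inferInstance : Fintype (geo9Y x).Site); M₀ ≤ (geo9Y x).M → ∀ α₀ : ℝ, 0 < α₀ → (geo9Y x).M * α₀ ≤ a₀ → ∀ U : (bg9YR (Matrix (Fin N) (Fin N) ℂ) (specialUnitaryUnits (Fin N)) R₁ R₂ x).Cfg, (bg9YR (Matrix (Fin N) (Fin N) ℂ) (specialUnitaryUnits (Fin N)) R₁ R₂ x).Reg335 c α₀ U →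
      (bg9YR (Matrix (Fin N) (Fin N) ℂ) (specialUnitaryUnits (Fin N)) R₁ R₂ x).Reg336 c α₀ U → ∀ (ν μ : Fin (d + 1)) (β' : ℝ) (h0 : 0 ≤ β') (h1 : β' < 1),
        HasMaj (bHZKP (κ := TrIdx N) x.toKIdx (trBasis N) (taxiB x.toKIdx (bg9YR (Matrix (Fin N) (Fin N) ℂ) (specialUnitaryUnits (Fin N)) R₁ R₂ x) (fun U => U) U) (R := (1 : ℝ)) (H := H x) (hsch0 β' h0 h1).le (hsch1 β' h0 h1).le) (cNormR 1 (H x) (𝔭A x).blkPX (fun y => (geo9Y_len_pos x y).le) (β' - 1))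
          ((𝔭A x).ΦX U β' ∘ₗ ((𝔡A x).Dd U ν ∘ₗ ((𝔬12 x).G0 U ∘ₗ (𝔡A x).Dsd U μ)))
          (fun a a' => BZ β' * Real.exp (-(δ45 * (geo9Y x).dist a a')))) :
    ∃ (MX : ℝ) (BdX : ℝ → ℝ), (∀ β', 0 ≤ β' → β' < 1 → 0 ≤ BdX β') ∧
      ∀ x : MemberY d ℓ hd hL b₀ b₁ Mstar, MX ≤ (geo9Y x).M → ∀ α₀ : ℝ, 0 < α₀ → (geo9Y x).M * α₀ ≤ a₀ →
        ∀ U : (bg9YR (Matrix (Fin N) (Fin N) ℂ) (specialUnitaryUnits (Fin N)) R₁ R₂ x).Cfg, (bg9YR (Matrix (Fin N) (Fin N) ℂ) (specialUnitaryUnits (Fin N)) R₁ R₂ x).Reg335 c α₀ U →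
          (bg9YR (Matrix (Fin N) (Fin N) ℂ) (specialUnitaryUnits (Fin N)) R₁ R₂ x).Reg336 c α₀ U → ∀ (ν : Fin (d + 1)) (β' : ℝ), 0 ≤ β' → β' < 1 →
            HasMaj (bH13 x U) (cNormR 1 (H x) (𝔭A x).blkPX (fun y => (geo9Y_len_pos x y).le) (β' - 1))
              (((𝔭A x).ΦX U β' ∘ₗ (𝔡A x).Dd U ν ∘ₗ (𝔬12 x).G0 U) ∘ₗ (𝔬12 x).Dv U)
              (fun a a' => BdX β' * Real.exp (-(δ₃ * (geo9Y x).dist a a'))) := by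
  -- the member facts of the (3.47) passage at α := 1∕2, δF := δ45 − δ₃ (J-letter rate shift only), and [4] (2.61) at rate 1
  have hδF : 0 < δ45 - δ₃ := sub_pos.2 hδ
  obtain ⟨Mg, hFa⟩ := facts347_exp261_geo9Y (d := d) (ℓ := ℓ) (hd := hd) (hL := hL) (b₀ := b₀) (b₁ := b₁) (Mstar := Mstar) H
    (α := 1 / 2) (by norm_num) (by norm_num) hδF
  obtain ⟨ML, c₁, hrow⟩ := rowSum261_geo9Y (d := d) (ℓ := ℓ) (hd := hd) (hL := hL) (b₀ := b₀) (b₁ := b₁) (Mstar := Mstar) 1 one_pos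
  set L₀ : ℝ := ((ℓ + 1 : ℕ) : ℝ) with hL₀
  set δJ : ℝ := δ₃ + 1 + 1 / 2 * (δ45 - δ₃) with hδJ
  have hδJ0 : 0 ≤ δJ := by rw [hδJ]; nlinarith
  refine ⟨max M₀ (max Mg ML),
    fun β' => ((d : ℝ) + 1) * ((1 + CLip d ℓ) * BZ β' * ((CJG d ℓ (trBasis N) (sch β') (thetaL d ℓ ϑF) (w13 (sch β')) δJ) * L₀) * max c₁ 0), ?_, ?_⟩
  · intro β' h0 h1
    have h1C : 0 ≤ 1 + CLip d ℓ := by linarith [one_le_CLip d ℓ]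
    have hJ := CJG_nonneg (d := d) (ℓ := ℓ) (trBasis N) (p := sch β') (thetaL_nonneg d ℓ hϑF) (hwsch β' h0 h1) δJ
    have := hBZ β' h0 h1
    positivity
  · intro x hM α₀ hα ha U hU hU' ν β' h0 h1
    letI : Fintype (geo9K x.toKIdx).Site := (inferInstance : Fintype (geo9Y x).Site)
    have hM0 : M₀ ≤ (geo9Y x).M := (le_max_left _ _).trans hM
    have hrowx : RowSum (toB6 (geo9Y x) 1 (H x)) 1 (max c₁ 0) := fun y => (hrow x (((le_max_right _ _).trans (le_max_right _ _)).trans hM) y).trans (le_max_left _ _)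
    have hFax : Facts347 (geo9Y x) 1 (H x) (exp261 (@geo9Y d ℓ hd hL b₀ b₁ Mstar) (δ45 - δ₃) (1 - 1 / 2)) (δ45 - δ₃) (1 / 2) L₀ :=
      hFa x (((le_max_left _ _).trans (le_max_right _ _)).trans hM)
    have hG : GeoOK (geo9Y x) := ⟨geo9Y_dist_triangle x, geo9Y_dist_comm x, geo9K_dist_nonneg x.toKIdx, geo9Y_len_pos x⟩
    have hcf : |x.toKIdx.cf| = (nKT (toKT x.toKIdx) : ℝ) := abs_cf_eq_nKT x.toKIdx x.hcfk
    have h1C : 0 ≤ 1 + CLip d ℓ := by linarith [one_le_CLip d ℓ]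
    have hCJ : 0 ≤ CJG d ℓ (trBasis N) (sch β') (thetaL d ℓ ϑF) (w13 (sch β')) δJ * (geo9Y x).L :=
      mul_nonneg (CJG_nonneg (d := d) (ℓ := ℓ) (trBasis N) (p := sch β') (thetaL_nonneg d ℓ hϑF) (hwsch β' h0 h1) δJ) (le_trans zero_le_one hFax.one_le_L)
    -- the kinematic decomposition `D_U = Σ_μ D*_{U,μ} ∘ J_μ(U)` at the ops pins and the length-free J-letter at the exponent `sch β'`
    have hDv' : (𝔬12 x).Dv U = ∑ μ, (𝔡A x).Dsd U μ ∘ₗ JcoKH x.toKIdx (trBasis N) (bg9YR (Matrix (Fin N) (Fin N) ℂ) (specialUnitaryUnits (Fin N)) R₁ R₂ x) (fun U => U) μ U := by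
      rw [hDvco12 x U, h𝔡As x U]; exact DvcoKH_eq_sum x.toKIdx (trBasis N) (bg9YR (Matrix (Fin N) (Fin N) ℂ) (specialUnitaryUnits (Fin N)) R₁ R₂ x) (fun U => U) U
    have hJ := fun μ => hJ_print x.toKIdx (bg9YR (Matrix (Fin N) (Fin N) ℂ) (specialUnitaryUnits (Fin N)) R₁ R₂ x) (fun U => U) (trBasis N) w13 hw13₀ hw13₁ (hsch0 β' h0 h1) (hsch1 β' h0 h1) (hwsch β' h0 h1) hFax hcf (hβ1 x) (hbI0 x)
      (links_le_one hGR x hU) hϑF (hF x hM0 α₀ hα ha U hU hU') hδJ0 μ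
    have hκ : (bHZKP (κ := TrIdx N) x.toKIdx (trBasis N) (taxiB x.toKIdx (bg9YR (Matrix (Fin N) (Fin N) ℂ) (specialUnitaryUnits (Fin N)) R₁ R₂ x) (fun U => U) U) (R := (1 : ℝ)) (H := H x) (hsch0 β' h0 h1).le (hsch1 β' h0 h1).le).κ ≤ 1 + CLip d ℓ :=
      le_of_eq (bHZKP_κ x.toKIdx (trBasis N) _ _ _)
    have hBdX : (Fintype.card (Fin (d + 1)) : ℝ) * ((1 + CLip d ℓ) * BZ β' * (CJG d ℓ (trBasis N) (sch β') (thetaL d ℓ ϑF) (w13 (sch β')) δJ * (geo9Y x).L) * max c₁ 0) ≤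
        ((d : ℝ) + 1) * ((1 + CLip d ℓ) * BZ β' * ((CJG d ℓ (trBasis N) (sch β') (thetaL d ℓ ϑF) (w13 (sch β')) δJ) * L₀) * max c₁ 0) := by
      rw [Fintype.card_fin, Nat.cast_add, Nat.cast_one]
      have hJ0 := CJG_nonneg (d := d) (ℓ := ℓ) (trBasis N) (p := sch β') (thetaL_nonneg d ℓ hϑF) (hwsch β' h0 h1) δJ
      have := hBZ β' h0 h1
      have hLx : (geo9Y x).L ≤ L₀ := (geo9Y_scalars x).2.1
      have hc0 : (0 : ℝ) ≤ max c₁ 0 := le_max_right _ _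
      gcongr
    have hr1 : δ₃ ≤ δ45 := hδ.le
    have hr2 : δ₃ + 1 ≤ δJ - 1 / 2 * (δ45 - δ₃) := by rw [hδJ]; linarith
    rw [hbH13 x U]
    exact pYDH_of_h45Y_one hG hrowx (hBZ β' h0 h1) hCJ (le_max_right _ _) hκ hδ₃ hr1 hr2 hBdX hDv'
      (fun μ => h45X x hM0 α₀ hα ha U hU hU' ν μ β' h0 h1) hJ

/-- ★★ **`pYDH` DERIVED ABOVE A CLOSED THRESHOLD AT THE PRINT-WEIGHTED PIN (P2′)** (module docstring): for any target rate `0 ≤ δ₃ < δ45`, from the PRINT-LITERAL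
Φ^Y-(3.45) members `h45Y′` (source `bHZKP (taxiB U) (sch β)`, target `𝔠_{P_Y}^{(β−1)}`, rate `δ45`, constants `Bi β`), the plaquette binder `hF` (budget `ϑF ≥ 0`) and the pin
(P2′), there are a threshold `MY` and a non-negative constant function `BhD` with `Letters313HZ.pYDH` INTO `bH13 x U` at rate `δ₃` for every member above `MY` — dag-n06-l's
generic `pYDH_of_h45Y_one` with the length-free J-letter `hJ_print`, `Facts347` (`α := 1∕2`, `δF := δ45 − δ₃`) and `RowSum` (`σ := 1`) discharged at the geometry of record. [cite: Balaban1985BackgroundPropagators, Thm 3.13 p.426 + Thm 3.3 p.399 + (3.45) p.398 + (3.3) p.390 + (3.35) p.396; Balaban1984PropagatorsII, (2.52)–(2.56) pp.232–233 + Lemma 2.1 (2.60)–(2.61) p.234] -/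
theorem pYDH_of_pinsP_geo9Y [NeZero N] [∀ x : MemberY d ℓ hd hL b₀ b₁ Mstar, Fintype (geo9Y x).Site]
    {R₁ R₂ : RegFamY d ℓ hd hL b₀ b₁ Mstar (Matrix (Fin N) (Fin N) ℂ)} (H : MemberY d ℓ hd hL b₀ b₁ Mstar → Prop)
    (bI : ∀ x : MemberY d ℓ hd hL b₀ b₁ Mstar, FBondY x.toKIdx → IBondY x.toKIdx)
    (hβ1 : ∀ (x : MemberY d ℓ hd hL b₀ b₁ Mstar) (f : FBondY x.toKIdx), (geomT x.D).dist (β x.hN x.D x.hk (bI x f)) (blkV1 x.hN x.D f) ≤ 1)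
    (hbI0 : ∀ (x : MemberY d ℓ hd hL b₀ b₁ Mstar) (f : FBondY x.toKIdx), bI x f = bI x ⟨f.src, 0⟩)
    (hGR : MemOfFam (specialUnitaryUnits (Fin N)) R₁) (c : ℝ) {M₀ a₀ : ℝ} {ϑF : ℝ} (hϑF : 0 ≤ ϑF)
    (hF : ∀ x : MemberY d ℓ hd hL b₀ b₁ Mstar, letI : Fintype (geo9K x.toKIdx).Site := (inferInstance : Fintype (geo9Y x).Site); M₀ ≤ (geo9Y x).M → ∀ α₀ : ℝ, 0 < α₀ → (geo9Y x).M * α₀ ≤ a₀ → ∀ U : (bg9YR (Matrix (Fin N) (Fin N) ℂ) (specialUnitaryUnits (Fin N)) R₁ R₂ x).Cfg, (bg9YR (Matrix (Fin N) (Fin N) ℂ) (specialUnitaryUnits (Fin N)) R₁ R₂ x).Reg335 c α₀ U →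
      (bg9YR (Matrix (Fin N) (Fin N) ℂ) (specialUnitaryUnits (Fin N)) R₁ R₂ x).Reg336 c α₀ U → ∀ (y : Site (PV d ℓ x.m x.K hd hL) 0) (μ' ν' : Fin (d + 1)),
        ‖(plaqV U y μ' ν' : Matrix (Fin N) (Fin N) ℂ) - 1‖ ≤ ϑF * (((((ℓ + 1 : ℕ) : ℝ)) ^ levY x.toKIdx (chartY x.toKIdx y))⁻¹))
    (w13 : ℝ → ℝ) (hw13₀ : ∀ s, 0 ≤ w13 s) (hw13₁ : ∀ s, w13 s ≤ 1) (sch : ℝ → ℝ) (hsch0 : ∀ β', 0 ≤ β' → β' < 1 → 0 < sch β') (hsch1 : ∀ β', 0 ≤ β' → β' < 1 → sch β' < 1)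
    (hwsch : ∀ β', 0 ≤ β' → β' < 1 → 0 < w13 (sch β'))
    (bH13 : ∀ x : MemberY d ℓ hd hL b₀ b₁ Mstar, (bg9YR (Matrix (Fin N) (Fin N) ℂ) (specialUnitaryUnits (Fin N)) R₁ R₂ x).Cfg → BlockNorm (toB6 (geo9Y x) 1 (H x)) (XSK (TrIdx N) x.toKIdx → ℝ))
    (hbH13 : ∀ (x : MemberY d ℓ hd hL b₀ b₁ Mstar) (U : (bg9YR (Matrix (Fin N) (Fin N) ℂ) (specialUnitaryUnits (Fin N)) R₁ R₂ x).Cfg), bH13 x U =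
      letI : Fintype (geo9K x.toKIdx).Site := (inferInstance : Fintype (geo9Y x).Site);
      bHZPG (κ := TrIdx N) x.toKIdx (trBasis N) (taxiS x.toKIdx (bg9YR (Matrix (Fin N) (Fin N) ℂ) (specialUnitaryUnits (Fin N)) R₁ R₂ x) (fun U => U) U) (R := (1 : ℝ)) (H := H x) w13 hw13₀ hw13₁)
    {ιA AA : MemberY d ℓ hd hL b₀ b₁ Mstar → Type}
    (𝔬A : ∀ x : MemberY d ℓ hd hL b₀ b₁ Mstar, Ops310 (geo9Y x) (bg9YR (Matrix (Fin N) (Fin N) ℂ) (specialUnitaryUnits (Fin N)) R₁ R₂ x) (XBK (TrIdx N) x.toKIdx) (XBK (TrIdx N) x.toKIdx) (ιA x) (AA x))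
    (𝔬12 : ∀ x : MemberY d ℓ hd hL b₀ b₁ Mstar, B9Thm312Whole.Ops (geo9Y x) (bg9YR (Matrix (Fin N) (Fin N) ℂ) (specialUnitaryUnits (Fin N)) R₁ R₂ x) (XBK (TrIdx N) x.toKIdx) (XBK (TrIdx N) x.toKIdx) (XHK (TrIdx N) x.toKIdx) (XSK (TrIdx N) x.toKIdx))
    (hDvco12 : ∀ (x : MemberY d ℓ hd hL b₀ b₁ Mstar) (U : (bg9YR (Matrix (Fin N) (Fin N) ℂ) (specialUnitaryUnits (Fin N)) R₁ R₂ x).Cfg), (𝔬12 x).Dv U = DvcoKH x.toKIdx (trBasis N) (bg9YR (Matrix (Fin N) (Fin N) ℂ) (specialUnitaryUnits (Fin N)) R₁ R₂ x) (fun U => U) U)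
    (𝔡A : ∀ x : MemberY d ℓ hd hL b₀ b₁ Mstar, DirOps310 (𝔬A x) (Fin (d + 1)))
    (h𝔡As : ∀ (x : MemberY d ℓ hd hL b₀ b₁ Mstar) (U : (bg9YR (Matrix (Fin N) (Fin N) ℂ) (specialUnitaryUnits (Fin N)) R₁ R₂ x).Cfg), (𝔡A x).Dsd U = fun μ => coordOpK (trBasis N) (fun _ : Fin (d + 1) => cdsBₗ x.toKIdx U μ))
    (𝔭A : ∀ x : MemberY d ℓ hd hL b₀ b₁ Mstar, HolderProbes (geo9Y x) (bg9YR (Matrix (Fin N) (Fin N) ℂ) (specialUnitaryUnits (Fin N)) R₁ R₂ x) (XBK (TrIdx N) x.toKIdx) (XBK (TrIdx N) x.toKIdx) (PK (FBondY x.toKIdx) (Fin (d + 1)) (TrIdx N)) (PK (FBondY x.toKIdx) (Fin (d + 1)) (TrIdx N)))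
    {δ45 δ₃ : ℝ} (hδ₃ : 0 ≤ δ₃) (hδ : δ₃ < δ45) {Bi : ℝ → ℝ} (hBi : ∀ β', 0 ≤ β' → β' < 1 → 0 ≤ Bi β')
    (h45Y : ∀ x : MemberY d ℓ hd hL b₀ b₁ Mstar, letI : Fintype (geo9K x.toKIdx).Site := (inferInstance : Fintype (geo9Y x).Site); M₀ ≤ (geo9Y x).M → ∀ α₀ : ℝ, 0 < α₀ → (geo9Y x).M * α₀ ≤ a₀ → ∀ U : (bg9YR (Matrix (Fin N) (Fin N) ℂ) (specialUnitaryUnits (Fin N)) R₁ R₂ x).Cfg, (bg9YR (Matrix (Fin N) (Fin N) ℂ) (specialUnitaryUnits (Fin N)) R₁ R₂ x).Reg335 c α₀ U →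
      (bg9YR (Matrix (Fin N) (Fin N) ℂ) (specialUnitaryUnits (Fin N)) R₁ R₂ x).Reg336 c α₀ U → ∀ (β' : ℝ) (h0 : 0 ≤ β') (h1 : β' < 1) (μ : Fin (d + 1)),
        HasMaj (bHZKP (κ := TrIdx N) x.toKIdx (trBasis N) (taxiB x.toKIdx (bg9YR (Matrix (Fin N) (Fin N) ℂ) (specialUnitaryUnits (Fin N)) R₁ R₂ x) (fun U => U) U) (R := (1 : ℝ)) (H := H x) (hsch0 β' h0 h1).le (hsch1 β' h0 h1).le) (cNormR 1 (H x) (𝔭A x).blkPY (fun y => (geo9Y_len_pos x y).le) (β' - 1))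
          ((𝔭A x).ΦY U β' ∘ₗ ((𝔬12 x).D U ∘ₗ ((𝔬12 x).G0 U ∘ₗ (𝔡A x).Dsd U μ)))
          (fun a a' => Bi β' * Real.exp (-(δ45 * (geo9Y x).dist a a')))) :
    ∃ (MY : ℝ) (BhD : ℝ → ℝ), (∀ β', 0 ≤ β' → β' < 1 → 0 ≤ BhD β') ∧
      ∀ x : MemberY d ℓ hd hL b₀ b₁ Mstar, MY ≤ (geo9Y x).M → ∀ α₀ : ℝ, 0 < α₀ → (geo9Y x).M * α₀ ≤ a₀ →
        ∀ U : (bg9YR (Matrix (Fin N) (Fin N) ℂ) (specialUnitaryUnits (Fin N)) R₁ R₂ x).Cfg, (bg9YR (Matrix (Fin N) (Fin N) ℂ) (specialUnitaryUnits (Fin N)) R₁ R₂ x).Reg335 c α₀ U →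
          (bg9YR (Matrix (Fin N) (Fin N) ℂ) (specialUnitaryUnits (Fin N)) R₁ R₂ x).Reg336 c α₀ U → ∀ β' : ℝ, 0 ≤ β' → β' < 1 →
            HasMaj (bH13 x U) (cNormR 1 (H x) (𝔭A x).blkPY (fun y => (geo9Y_len_pos x y).le) (β' - 1))
              (((𝔭A x).ΦY U β' ∘ₗ (𝔬12 x).D U ∘ₗ (𝔬12 x).G0 U) ∘ₗ (𝔬12 x).Dv U)
              (fun a a' => BhD β' * Real.exp (-(δ₃ * (geo9Y x).dist a a'))) := by
  -- the member facts of the (3.47) passage at α := 1∕2, δF := δ45 − δ₃ (J-letter rate shift only), and [4] (2.61) at rate 1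
  have hδF : 0 < δ45 - δ₃ := sub_pos.2 hδ
  obtain ⟨Mg, hFa⟩ := facts347_exp261_geo9Y (d := d) (ℓ := ℓ) (hd := hd) (hL := hL) (b₀ := b₀) (b₁ := b₁) (Mstar := Mstar) H
    (α := 1 / 2) (by norm_num) (by norm_num) hδF
  obtain ⟨ML, c₁, hrow⟩ := rowSum261_geo9Y (d := d) (ℓ := ℓ) (hd := hd) (hL := hL) (b₀ := b₀) (b₁ := b₁) (Mstar := Mstar) 1 one_pos
  set L₀ : ℝ := ((ℓ + 1 : ℕ) : ℝ) with hL₀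
  set δJ : ℝ := δ₃ + 1 + 1 / 2 * (δ45 - δ₃) with hδJ
  have hδJ0 : 0 ≤ δJ := by rw [hδJ]; nlinarith
  have h1C : 0 ≤ 1 + CLip d ℓ := by linarith [one_le_CLip d ℓ]
  have hc0 : (0 : ℝ) ≤ max c₁ 0 := le_max_right _ _
  refine ⟨max M₀ (max Mg ML),
    fun β' => ((d : ℝ) + 1) * ((1 + CLip d ℓ) * Bi β' * ((CJG d ℓ (trBasis N) (sch β') (thetaL d ℓ ϑF) (w13 (sch β')) δJ) * L₀) * max c₁ 0), ?_, ?_⟩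
  · intro β' h0 h1
    have hJ := CJG_nonneg (d := d) (ℓ := ℓ) (trBasis N) (p := sch β') (thetaL_nonneg d ℓ hϑF) (hwsch β' h0 h1) δJ
    have := hBi β' h0 h1
    positivity
  · intro x hM α₀ hα ha U hU hU' β' h0 h1
    letI : Fintype (geo9K x.toKIdx).Site := (inferInstance : Fintype (geo9Y x).Site)
    have hM0 : M₀ ≤ (geo9Y x).M := (le_max_left _ _).trans hM
    have hrowx : RowSum (toB6 (geo9Y x) 1 (H x)) 1 (max c₁ 0) := fun y => (hrow x (((le_max_right _ _).trans (le_max_right _ _)).trans hM) y).trans (le_max_left _ _)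
    have hFax : Facts347 (geo9Y x) 1 (H x) (exp261 (@geo9Y d ℓ hd hL b₀ b₁ Mstar) (δ45 - δ₃) (1 - 1 / 2)) (δ45 - δ₃) (1 / 2) L₀ :=
      hFa x (((le_max_left _ _).trans (le_max_right _ _)).trans hM)
    have hG : GeoOK (geo9Y x) := ⟨geo9Y_dist_triangle x, geo9Y_dist_comm x, geo9K_dist_nonneg x.toKIdx, geo9Y_len_pos x⟩
    have hcf : |x.toKIdx.cf| = (nKT (toKT x.toKIdx) : ℝ) := abs_cf_eq_nKT x.toKIdx x.hcfk
    have hCJ : 0 ≤ CJG d ℓ (trBasis N) (sch β') (thetaL d ℓ ϑF) (w13 (sch β')) δJ * (geo9Y x).L :=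
      mul_nonneg (CJG_nonneg (d := d) (ℓ := ℓ) (trBasis N) (p := sch β') (thetaL_nonneg d ℓ hϑF) (hwsch β' h0 h1) δJ) (le_trans zero_le_one hFax.one_le_L)
    -- the kinematic decomposition `D_U = Σ_μ D*_{U,μ} ∘ J_μ(U)` at the ops pins and the length-free J-letter at the exponent `sch β'`
    have hDv' : (𝔬12 x).Dv U = ∑ μ, (𝔡A x).Dsd U μ ∘ₗ JcoKH x.toKIdx (trBasis N) (bg9YR (Matrix (Fin N) (Fin N) ℂ) (specialUnitaryUnits (Fin N)) R₁ R₂ x) (fun U => U) μ U := by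
      rw [hDvco12 x U, h𝔡As x U]; exact DvcoKH_eq_sum x.toKIdx (trBasis N) (bg9YR (Matrix (Fin N) (Fin N) ℂ) (specialUnitaryUnits (Fin N)) R₁ R₂ x) (fun U => U) U
    have hJ := fun μ => hJ_print x.toKIdx (bg9YR (Matrix (Fin N) (Fin N) ℂ) (specialUnitaryUnits (Fin N)) R₁ R₂ x) (fun U => U) (trBasis N) w13 hw13₀ hw13₁ (hsch0 β' h0 h1) (hsch1 β' h0 h1) (hwsch β' h0 h1) hFax hcf (hβ1 x) (hbI0 x)
      (links_le_one hGR x hU) hϑF (hF x hM0 α₀ hα ha U hU hU') hδJ0 μ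
    have hκ : (bHZKP (κ := TrIdx N) x.toKIdx (trBasis N) (taxiB x.toKIdx (bg9YR (Matrix (Fin N) (Fin N) ℂ) (specialUnitaryUnits (Fin N)) R₁ R₂ x) (fun U => U) U) (R := (1 : ℝ)) (H := H x) (hsch0 β' h0 h1).le (hsch1 β' h0 h1).le).κ ≤ 1 + CLip d ℓ :=
      le_of_eq (bHZKP_κ x.toKIdx (trBasis N) _ _ _)
    have hBhD : (Fintype.card (Fin (d + 1)) : ℝ) * ((1 + CLip d ℓ) * Bi β' * (CJG d ℓ (trBasis N) (sch β') (thetaL d ℓ ϑF) (w13 (sch β')) δJ * (geo9Y x).L) * max c₁ 0) ≤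
        ((d : ℝ) + 1) * ((1 + CLip d ℓ) * Bi β' * ((CJG d ℓ (trBasis N) (sch β') (thetaL d ℓ ϑF) (w13 (sch β')) δJ) * L₀) * max c₁ 0) := by
      rw [Fintype.card_fin, Nat.cast_add, Nat.cast_one]
      have hJ0 := CJG_nonneg (d := d) (ℓ := ℓ) (trBasis N) (p := sch β') (thetaL_nonneg d ℓ hϑF) (hwsch β' h0 h1) δJ
      have := hBi β' h0 h1
      have hLx : (geo9Y x).L ≤ L₀ := (geo9Y_scalars x).2.1
      gcongr
    have hr1 : δ₃ ≤ δ45 := hδ.le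
    have hr2 : δ₃ + 1 ≤ δJ - 1 / 2 * (δ45 - δ₃) := by rw [hδJ]; linarith
    rw [hbH13 x U]
    exact pYDH_of_h45Y_one hG hrowx (hBi β' h0 h1) hCJ hc0 hκ hδ₃ hr1 hr2 hBhD hDv'
      (fun μ => h45Y x hM0 α₀ hα ha U hU hU' β' h0 h1 μ) hJ

end Summit.QuantumFields.YangMills.BalabanUVNodes.N06XdYdLegAtPinsPhysPU

end
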